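import Mathlib
import Summits.Schanuel.Schanuel.Theorems.DiophantineDichotomyApproximationPropertySliceTwo
import Literature.NumberTheory.Transcendental.RankOneGridTrdeg
import HarnessLib

/-!
# Route `DiophantineDichotomy`, crux `KhovanskiiApproxTypeEv` (stmt-Schanuel-14972), line `lambert-liouville-kill`:
# stub `stub_syncApproximant` — the synchronised approximant of the pair `(iπ, e)`

Crux `Summit.Schanuel.Schanuel.Theses.DiophantineDichotomy.KhovanskiiApproxTypeEv` (item stmt-Schanuel-14972),
certificate line `lambert-liouville-kill` (skeleton `Cruxes/KhovanskiiApproxTypeEv/Lines/lambert_liouville_kill.lean`,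
lead `prover-line-stmt-Schanuel-14972-a1-0`), registered stub `stub_syncApproximant` (landed `--supports stmt-Schanuel-14972`).

STUB 8 of the rank-3 (anchored) certificate `notLiouville_lambert_of_evAnchored`: given a per-degree
measure of algebraic approximation of `e` (`|e − α| ≥ c₀ H^{−κ}` at degree `≤ N`, the statement of
STUB 2, taken here as a HYPOTHESIS), Philippon's approximation property in transcendence degree `≤ 2`
(`Summit.Schanuel.Schanuel.Theorems.approximationProperty_trdeg_le_two`, PROVED in tree) at the pair
`θ₂ = (iπ, e)` (`trdeg_ℚ ℚ(iπ, e) ≤ 2` by `Literature.NumberTheory.Transcendental.trdeg_adjoin_le_mk`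
and `Cardinal.mk_range_le`) can be SYNCHRONISED with any scale `q`: with `c ≥ 1` the constant of the
approximation property, for every `Δ ≥ c` there are `M₀ > 0` and `q₁ = 2` such that every `q ≥ q₁`
carries an algebraic pair `γ₂` with `[ℚ(γ₂):ℚ] ≤ d₂ ≤ (cΔ)²`, certificates of height `≤ H₂`,
`q ≤ H₂ ≤ q^{M₀}` and `‖γ₂ − θ₂‖ ≤ H₂^{−Δ/c}`.  Proof: run the approximation property at `(Δ, Y)` with
the free scale `Y := max Δ (c (κ log q − log c₀))` (`κ, c₀` the measure constants at
`N := ⌈(cΔ)²⌉₊`); the `e`-coordinate `α` of the approximant has `|e − α| ≤ exp(−Y/c)` (as `d ≥ 1`,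
`H ≥ 1`, read off the certificates), so the measure forces `κ log q ≤ κ log H`, i.e. `q ≤ H`; the
height clause `log H ≤ cYΔ ≤ M₀ log q` gives `H ≤ q^{M₀}`; and `exp(−(Δ log H + dY)/c) ≤ H^{−Δ/c}`.
Pure real-analysis bookkeeping on top of the two tree inputs.
-/

noncomputable section

-- `Summit.Schanuel.Schanuel.…` is the mandated summit/sub-problem namespace (single-conjunct summit), hence:
set_option linter.dupNamespace false

namespace Summit.Schanuel.Schanuel.Cruxes.KhovanskiiApproxTypeEv.LambertLiouvilleKill

open Polynomial

/-- A pair of complex numbers generates a field of transcendence degree `≤ 2` over `ℚ`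
(`trdeg_ℚ ℚ(S) ≤ #S` and `#(range θ) ≤ #(Fin 2) = 2`). [folklore] -/
lemma trdeg_adjoin_pair_le_two (θ : Fin 2 → ℂ) :
    Algebra.trdeg ℚ ↥(IntermediateField.adjoin ℚ (Set.range θ)) ≤ (2 : Cardinal) :=
  calc Algebra.trdeg ℚ ↥(IntermediateField.adjoin ℚ (Set.range θ)) ≤ Cardinal.mk (Set.range θ) :=
        Literature.NumberTheory.Transcendental.trdeg_adjoin_le_mk _
    _ ≤ Cardinal.mk (Fin 2) := Cardinal.mk_range_le
    _ = 2 := by simp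

/-- A non-zero integer polynomial whose coefficients are bounded in absolute value by `H : ℕ` forces
`1 ≤ H` (if `H = 0` every coefficient vanishes). [folklore] -/
lemma one_le_of_coeff_abs_le {P : ℤ[X]} {H : ℕ} (hP : P ≠ 0) (hH : ∀ j, |P.coeff j| ≤ (H : ℤ)) :
    1 ≤ H := by
  by_contra h
  have hH0 : H = 0 := by omega
  apply hP
  ext j
  have hj := hH j
  rw [hH0, Nat.cast_zero, abs_nonpos_iff] at hj
  simpa using hj

/-- A non-zero integer polynomial with a complex root has positive degree (`ℤ → ℂ` is injective).
[folklore] -/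
lemma one_le_natDegree_of_aeval_eq_zero {P : ℤ[X]} {z : ℂ} (hP : P ≠ 0)
    (hz : Polynomial.aeval z P = 0) : 1 ≤ P.natDegree :=
  natDegree_pos_of_aeval_root hP hz (fun x hx => by simpa using hx)

/-- The `e`-coordinate of the error: `‖e − γ 1‖ ≤ ‖γ − (iπ, e)‖` in the sup norm of `ℂ²`. [folklore] -/
lemma norm_exp_one_sub_le_norm_sub_pair (γ : Fin 2 → ℂ) :
    ‖Complex.exp 1 - γ 1‖ ≤ ‖γ - ![Complex.I * Real.pi, Complex.exp 1]‖ := by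
  have h := norm_le_pi_norm (γ - ![Complex.I * Real.pi, Complex.exp 1]) 1
  have h1 : (γ - ![Complex.I * Real.pi, Complex.exp 1]) 1 = γ 1 - Complex.exp 1 := by simp
  rw [h1, norm_sub_rev] at h
  exact h

/-- Height synchronisation, lower bound: if `c₀ H^{−κ} ≤ exp(−Y/c)` with `c (κ log q − log c₀) ≤ Y`
(`c, c₀, κ, q, H > 0`), then `q ≤ H` (take logarithms: `log c₀ − κ log H ≤ −Y/c ≤ log c₀ − κ log q`).
[folklore] -/
lemma le_of_measure_le_exp {c c₀ κ Y q H : ℝ} (hc : 0 < c) (hc₀ : 0 < c₀) (hκ : 0 < κ) (hq : 0 < q)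
    (hH : 0 < H) (hY : c * (κ * Real.log q - Real.log c₀) ≤ Y)
    (hkey : c₀ * H ^ (-κ) ≤ Real.exp (-(Y / c))) : q ≤ H := by
  have hpow : 0 < H ^ (-κ) := Real.rpow_pos_of_pos hH _
  have hlog1 : Real.log c₀ + -κ * Real.log H ≤ -(Y / c) := by
    have h := Real.log_le_log (mul_pos hc₀ hpow) hkey
    rwa [Real.log_exp, Real.log_mul hc₀.ne' hpow.ne', Real.log_rpow hH] at h
  have hYc : κ * Real.log q - Real.log c₀ ≤ Y / c := by
    rw [le_div_iff₀ hc]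
    linarith
  have hκlog : κ * Real.log q ≤ κ * Real.log H := by linarith
  exact (Real.log_le_log_iff hq hH).mp (le_of_mul_le_mul_left hκlog hκ)

/-- Height synchronisation, upper bound: from `log H ≤ B` and `B ≤ M₀ log q` (`q, H > 0`) we get
`H ≤ q^{M₀}`. [folklore] -/
lemma le_rpow_of_log_le {q H B M₀ : ℝ} (hq : 0 < q) (hH : 0 < H) (h1 : Real.log H ≤ B)
    (h2 : B ≤ M₀ * Real.log q) : H ≤ q ^ M₀ :=
  calc H = Real.exp (Real.log H) := (Real.exp_log hH).symm
    _ ≤ Real.exp (Real.log q * M₀) := Real.exp_le_exp.mpr (by rw [mul_comm]; exact h1.trans h2)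
    _ = q ^ M₀ := (Real.rpow_def_of_pos hq M₀).symm

/-- Quality in height form: `exp(−(log H · Δ + d · Y)/c) ≤ H^{−Δ/c}` for `c, H > 0` and `d · Y ≥ 0`.
[folklore] -/
lemma exp_neg_le_rpow_neg {c Δ Y H d : ℝ} (hc : 0 < c) (hH : 0 < H) (hdY : 0 ≤ d * Y) :
    Real.exp (-((Real.log H * Δ + d * Y) / c)) ≤ H ^ (-(Δ / c)) := by
  rw [Real.rpow_def_of_pos hH, Real.exp_le_exp]
  have h1 : Real.log H * Δ / c ≤ (Real.log H * Δ + d * Y) / c :=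
    div_le_div_of_nonneg_right (by linarith) hc.le
  have h2 : Real.log H * (-(Δ / c)) = -(Real.log H * Δ / c) := by ring
  rw [h2]
  linarith

/-- The budget of the free scale: with `L = log q ≥ 1/2`, `c, Δ, κ ≥ 0` and
`Y ≤ Δ + c κ L + c |log c₀|`, one has `c Y Δ ≤ (2cΔ² + c²Δκ + 2c²Δ|log c₀|) L`. [folklore] -/
lemma scale_budget_le {c Δ κ Y L l₀ : ℝ} (hc : 0 ≤ c) (hΔ : 0 ≤ Δ) (hl₀ : 0 ≤ l₀)
    (hL : 1 ≤ 2 * L) (hY : Y ≤ Δ + c * κ * L + c * l₀) :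
    c * Y * Δ ≤ (2 * c * Δ * Δ + c * c * Δ * κ + 2 * c * c * Δ * l₀) * L := by
  have hcΔ : 0 ≤ c * Δ := mul_nonneg hc hΔ
  have e1 : c * Δ * Δ ≤ c * Δ * Δ * (2 * L) :=
    le_mul_of_one_le_right (mul_nonneg hcΔ hΔ) hL
  have e2 : c * c * Δ * l₀ ≤ c * c * Δ * l₀ * (2 * L) :=
    le_mul_of_one_le_right (mul_nonneg (mul_nonneg (mul_nonneg hc hc) hΔ) hl₀) hL
  calc c * Y * Δ = (c * Δ) * Y := by ring
    _ ≤ (c * Δ) * (Δ + c * κ * L + c * l₀) := mul_le_mul_of_nonneg_left hY hcΔ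
    _ = c * Δ * Δ + c * c * Δ * κ * L + c * c * Δ * l₀ := by ring
    _ ≤ c * Δ * Δ * (2 * L) + c * c * Δ * κ * L + c * c * Δ * l₀ * (2 * L) := by linarith
    _ = (2 * c * Δ * Δ + c * c * Δ * κ + 2 * c * c * Δ * l₀) * L := by ring

/-- **STUB 8 (the SYNCHRONISED approximant of `(iπ, e)`).**  Given a per-degree measure of algebraic
approximation of `e` (`|e − α| ≥ c₀ H^{−κ}` for roots `α` of non-zero `P ∈ ℤ[X]` of degree `≤ N` and
height `≤ H`): there is `c ≥ 1` (the constant of `approximationProperty_trdeg_le_two` at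
`θ₂ = (iπ, e)`, `trdeg_ℚ ℚ(iπ, e) ≤ 2` by `trdeg_adjoin_le_mk` and `Cardinal.mk_range_le`) such that
for every `Δ ≥ c` there are `M₀ > 0`, `q₁` with: every scale `q ≥ q₁` carries `γ₂ ∈ ℚ̄²` with
`[ℚ(γ₂):ℚ] ≤ d₂ ≤ (cΔ)²`, certificates of height `≤ H₂`, `q ≤ H₂ ≤ q^{M₀}`, `‖γ₂ − (iπ, e)‖ ≤ H₂^{−Δ/c}`.
Proof: the approximation property at `(Δ, Y)`, `Y := max Δ (c (κ log q − log c₀))` (`κ, c₀` the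
measure constants at `N := ⌈(cΔ)²⌉₊`): the `e`-coordinate has `|e − α| ≤ exp(−Y/c)` (`d₂ ≥ 1`,
`H₂ ≥ 1` from the certificates), so the measure forces `q ≤ H₂`; `log H₂ ≤ cYΔ ≤ M₀ log q` with
`M₀ := 2cΔ² + c²Δκ + 2c²Δ|log c₀|` (`q ≥ 2`); and `exp(−(Δ log H₂ + d₂Y)/c) ≤ H₂^{−Δ/c}`.
[cite: NesterenkoPhilippon2001, Ch. 4 §4 (p. 61)] -/
theorem stub_syncApproximant :
    (∀ N : ℕ, 1 ≤ N → ∃ κ c₀ : ℝ, 0 < κ ∧ 0 < c₀ ∧ ∀ (α : ℂ) (P : ℤ[X]) (H : ℕ), P ≠ 0 →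
      Polynomial.aeval α P = 0 → P.natDegree ≤ N → 1 ≤ H → (∀ j, |P.coeff j| ≤ (H : ℤ)) →
      c₀ * (H : ℝ) ^ (-κ) ≤ ‖Complex.exp 1 - α‖) →
    ∃ c : ℝ, 1 ≤ c ∧ ∀ Δ : ℝ, c ≤ Δ → ∃ M₀ : ℝ, 0 < M₀ ∧ ∃ q₁ : ℕ, ∀ q : ℕ, q₁ ≤ q →
      ∃ (γ₂ : Fin 2 → ℂ) (d₂ H₂ : ℕ),
        Module.finrank ℚ ↥(IntermediateField.adjoin ℚ (Set.range γ₂)) ≤ d₂ ∧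
        (∀ i, ∃ P : ℤ[X], P ≠ 0 ∧ P.natDegree ≤ d₂ ∧ (∀ j, |P.coeff j| ≤ (H₂ : ℤ)) ∧
          Polynomial.aeval (γ₂ i) P = 0) ∧
        (d₂ : ℝ) ≤ (c * Δ) ^ 2 ∧ q ≤ H₂ ∧ (H₂ : ℝ) ≤ (q : ℝ) ^ M₀ ∧
        ‖γ₂ - ![Complex.I * Real.pi, Complex.exp 1]‖ ≤ (H₂ : ℝ) ^ (-(Δ / c)) := by
  intro hmeasure
  -- Philippon's approximation property in transcendence degree ≤ 2 at the pair θ₂ = (iπ, e)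
  obtain ⟨c, hc1, hall⟩ :=
    Summit.Schanuel.Schanuel.Theorems.approximationProperty_trdeg_le_two (Fin 2)
      ![Complex.I * Real.pi, Complex.exp 1] (trdeg_adjoin_pair_le_two _)
  refine ⟨c, hc1, fun Δ hcΔ => ?_⟩
  have hc0 : 0 < c := by linarith
  have hΔ1 : 1 ≤ Δ := hc1.trans hcΔ
  have hΔ0 : 0 ≤ Δ := by linarith
  -- the degree budget `N = ⌈(cΔ)²⌉₊` and the measure constants `κ, c₀` at `N`
  have hcΔpos : 0 < (c * Δ) ^ 2 := by positivity
  have hN1 : 1 ≤ ⌈(c * Δ) ^ 2⌉₊ := Nat.one_le_iff_ne_zero.mpr (Nat.ceil_pos.mpr hcΔpos).ne'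
  obtain ⟨κ, c₀, hκ, hc₀, hmeas⟩ := hmeasure ⌈(c * Δ) ^ 2⌉₊ hN1
  have hl₀ : 0 ≤ |Real.log c₀| := abs_nonneg _
  -- the exponent `M₀` and the threshold `q₁ = 2`
  refine ⟨2 * c * Δ * Δ + c * c * Δ * κ + 2 * c * c * Δ * |Real.log c₀|, by positivity, 2,
    fun q hq => ?_⟩
  have hqpos : (0 : ℝ) < q := by exact_mod_cast (show 0 < q by omega)
  have hlogq0 : 0 ≤ Real.log q := Real.log_natCast_nonneg q
  have hlogq2 : Real.log 2 ≤ Real.log q := Real.log_le_log two_pos (by exact_mod_cast hq)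
  have hL : 1 ≤ 2 * Real.log q := by linarith [Real.log_two_gt_d9]
  -- the free scale `Y = max Δ (c (κ log q − log c₀))`
  obtain ⟨Y, hΔY, hYge, hYle⟩ : ∃ Y : ℝ, Δ ≤ Y ∧ c * (κ * Real.log q - Real.log c₀) ≤ Y ∧
      Y ≤ Δ + c * κ * Real.log q + c * |Real.log c₀| := by
    refine ⟨max Δ (c * (κ * Real.log q - Real.log c₀)), le_max_left _ _, le_max_right _ _,
      max_le ?_ ?_⟩
    · have h1 : 0 ≤ c * κ * Real.log q := by positivity
      have h2 : 0 ≤ c * |Real.log c₀| := by positivity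
      linarith
    · have h1 : c * (-Real.log c₀) ≤ c * |Real.log c₀| :=
        mul_le_mul_of_nonneg_left (neg_le_abs _) hc0.le
      linarith
  have hY0 : 0 ≤ Y := hΔ0.trans hΔY
  -- the approximant of (iπ, e) at (Δ, Y)
  obtain ⟨γ, d, H, hfr, hcert, hd, hlogH, hdist⟩ := hall Δ Y hcΔ hΔY
  -- its `e`-coordinate `α = γ 1` and the certificate of `α`: `H ≥ 1`, `d ≥ 1`, `d ≤ N`
  obtain ⟨P, hP0, hPdeg, hPcoef, hPα⟩ := hcert 1
  have hH1 : 1 ≤ H := one_le_of_coeff_abs_le hP0 hPcoef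
  have hd1 : 1 ≤ d := (one_le_natDegree_of_aeval_eq_zero hP0 hPα).trans hPdeg
  have hdN : d ≤ ⌈(c * Δ) ^ 2⌉₊ := by
    have h1 : (d : ℝ) ≤ ((⌈(c * Δ) ^ 2⌉₊ : ℕ) : ℝ) := hd.trans (Nat.le_ceil _)
    exact_mod_cast h1
  have hHpos : (0 : ℝ) < H := by exact_mod_cast hH1
  have hlogH0 : 0 ≤ Real.log H := Real.log_nonneg (by exact_mod_cast hH1)
  have hd1' : (1 : ℝ) ≤ d := by exact_mod_cast hd1
  have hdY : 0 ≤ (d : ℝ) * Y := by positivity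
  -- the measure at `α`, against the quality of the approximant: `c₀ H^{−κ} ≤ exp(−Y/c)`
  have hmeasα := hmeas (γ 1) P H hP0 hPα (hPdeg.trans hdN) hH1 hPcoef
  have hexpY : Real.exp (-((Real.log H * Δ + d * Y) / c)) ≤ Real.exp (-(Y / c)) := by
    rw [Real.exp_le_exp]
    have h1 : Y ≤ Real.log H * Δ + d * Y := by nlinarith
    have h2 : Y / c ≤ (Real.log H * Δ + d * Y) / c := div_le_div_of_nonneg_right h1 hc0.le
    linarith
  have hkey : c₀ * (H : ℝ) ^ (-κ) ≤ Real.exp (-(Y / c)) :=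
    hmeasα.trans ((norm_exp_one_sub_le_norm_sub_pair γ).trans (hdist.trans hexpY))
  -- lower height bound `q ≤ H`
  have hqH : q ≤ H := by
    have h : (q : ℝ) ≤ H := le_of_measure_le_exp hc0 hc₀ hκ hqpos hHpos hYge hkey
    exact_mod_cast h
  -- upper height bound `H ≤ q^{M₀}`
  have hbudget := scale_budget_le hc0.le hΔ0 hl₀ hL hYle
  have hHle : (H : ℝ) ≤ (q : ℝ) ^ (2 * c * Δ * Δ + c * c * Δ * κ + 2 * c * c * Δ * |Real.log c₀|) :=
    le_rpow_of_log_le hqpos hHpos hlogH hbudget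
  -- quality in height form
  have hqual : ‖γ - ![Complex.I * Real.pi, Complex.exp 1]‖ ≤ (H : ℝ) ^ (-(Δ / c)) :=
    hdist.trans (exp_neg_le_rpow_neg hc0 hHpos hdY)
  exact ⟨γ, d, H, hfr, hcert, hd, hqH, hHle, hqual⟩

end Summit.Schanuel.Schanuel.Cruxes.KhovanskiiApproxTypeEv.LambertLiouvilleKill

end
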